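import Literature.NumberTheory.GaloisRepresentations.LubinTateTowerTrace
import HarnessLib

/-!
# Trace-coherent integral normal bases along an unramified tower: generators `θ_m` of `𝒪_{E_m}` over `𝒪_F[Gal(E_m/F)]` with
# `Tr_{E_{m+1}/E_m} θ_{m+1} = θ_m` (the integral normal basis theorem in the limit `lim←_{Tr} 𝒪_{E_m} ≅ 𝒪_F⟦Gal(E_∞/F)⟧`)

De Shalit, *Iwasawa theory of elliptic curves with complex multiplication* (1987), Ch. I §3.8: the exact sequences (13) of Theorem I.3.7 over
the unramified layers `k′ ⊂ k″ ⊂ ⋯` are assembled along the surjective vertical arrows of (16) into the limit sequence (17); Ch. III §1.3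
(p. 90): "`Ker(j) = 𝒪′ ⊗ 𝓛` … since `k′/k` is unramified" — the integers of the unramified layers are free of rank one over the group ring
(Noether's integral normal basis theorem in the unramified = tame case, Fröhlich, *Galois module structure*, Ch. I §3), and COMPATIBLY SO
along the tower.  This file proves the compatibility, which is what the series-currency description `lim←_{Tr} 𝒪_{E_m}⟦Y⟧ ≅ 𝒪_F⟦Gal(E_∞/F)⟧⟦Y⟧`
of the coordinate module of brick (c) needs (memo `BRICK-C-NORM-g7.md` §4 (iii), §6 "(L)"):

* `IsIntegralNormalGen E θ` — `θ ∈ 𝒪_E` generates an integral normal basis: the conjugates `σθ`, `σ ∈ Aut_F(E)`, span `𝒪_E` over `𝒪_F`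
  (for `E/F` Galois they are then an `𝒪_F`-basis: `IsIntegralNormalGen.linearIndependent`, `IsIntegralNormalGen.basis`);
* `exists_isIntegralNormalGen` — existence for `E ⊆ F^{nr}` finite Galois (the tree's `exists_basis_eq_pow_apply`, reindexed by `Gal(E/F) = ⟨φ⟩`);
* ★ `IsIntegralNormalGen.of_norm_sub_lt_one` — the property only depends on `θ mod π` (Nakayama), hence ★ `isOpen_/isClosed_setOf_isIntegralNormalGen`;
* ★★ `IsIntegralNormalGen.unitBallTrace` — **`Tr_{E₂/E₁}` maps normal integral generators of `𝒪_{E₂}` to normal integral generators of `𝒪_{E₁}`**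
  (`E₁ ≤ E₂` finite Galois over `F`; the coordinates of `ι y`, `y ∈ 𝒪_{E₁}`, are constant on the cosets of `Gal(E₂/E₁)`, and
  `ι(σ̄ Tr θ) = Σ_{σ|_{E₁} = σ̄} σθ`) — in particular `Tr_{E₂/E₁}(𝒪_{E₂}) = 𝒪_{E₁}` (`unitBallTrace_surjective`);
* ★★★ `exists_traceCoherent_isIntegralNormalGen` — **along any tower `E₀ ≤ E₁ ≤ ⋯` of finite Galois subextensions of `F^{nr}` there are
  normal integral generators `θ_m ∈ 𝒪_{E_m}` with `Tr_{E_{m+1}/E_m} θ_{m+1} = θ_m` for all `m`** (Cantor's intersection theorem in the compact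
  space `∏_m 𝒪_{E_m}`: the generator sets are closed and traces of generators are generators).

Everything PROVED (0 sorry, no named facts).

## References

* E. de Shalit, *Iwasawa theory of elliptic curves with complex multiplication* (1987), Ch. I §3.8 (16)–(17); Ch. III §1.3 (p. 90). [deShalit1987]
* J.-P. Serre, *Local Fields* (1979), Ch. I §4 Prop. 10; Ch. V §2. [SerreLocalFields1979]
-/

noncomputable section

namespace Literature.NumberTheory.GaloisRepresentations

section UnramifiedNormalGen

open GaloisRepresentations.IsNonarchimedeanLocalField LubinTate ValuativeRel Field

variable {F : Type} [Field F] [ValuativeRel F] [TopologicalSpace F] [IsNonarchimedeanLocalField F]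

attribute [local instance] ltNormUniformSpace ltNormIsUniformAddGroup rk1 nF nE fintypeResidueField

variable {π : 𝒪[F]} (hπ : (valuation F).IsUniformizer (π : F))
variable (E : IntermediateField F (AlgebraicClosure F)) [FiniteDimensional F E]

/-! ### Small lemmas on `unitBallEquiv` and `inclUnitBall` -/

/-- `(στ) z = σ (τ z)` on `𝒪_E`. [cite: SerreLocalFields1979, Ch. II §2] -/
theorem unitBallEquiv_mul_apply (σ τ : E ≃ₐ[F] E) (z : unitBall E) :
    unitBallEquiv E (σ * τ) z = unitBallEquiv E σ (unitBallEquiv E τ z) :=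
  Subtype.ext (by rw [coe_unitBallEquiv, coe_unitBallEquiv, coe_unitBallEquiv, AlgEquiv.mul_apply])

/-- `σ (a • z) = a • σ z` for `a ∈ 𝒪_F` (`σ` is `𝒪_F`-linear on `𝒪_E`). [cite: SerreLocalFields1979, Ch. II §2] -/
theorem unitBallEquiv_smul (σ : E ≃ₐ[F] E) (a : 𝒪[F]) (z : unitBall E) :
    unitBallEquiv E σ (a • z) = a • unitBallEquiv E σ z := by
  rw [Algebra.smul_def, map_mul, unitBallEquiv_algebraMap, Algebra.smul_def]

omit [FiniteDimensional F E] in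
/-- `ι (a • z) = a • ι z` for `a ∈ 𝒪_F` along `E₁ ≤ E₂` (the inclusion is `𝒪_F`-linear). [cite: SerreLocalFields1979, Ch. II §2] -/
theorem inclUnitBall_smul {E₁ E₂ : IntermediateField F (AlgebraicClosure F)} [FiniteDimensional F E₁] [FiniteDimensional F E₂]
    (h : E₁ ≤ E₂) (a : 𝒪[F]) (z : unitBall E₁) : inclUnitBall (F := F) h (a • z) = a • inclUnitBall (F := F) h z := by
  apply Subtype.ext
  rw [Algebra.smul_def, Algebra.smul_def, map_mul, Subring.coe_mul, Subring.coe_mul, coe_inclUnitBall, algebraMap_integer_apply,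
    coe_inclUnitBall, algebraMap_integer_apply, AlgHom.commutes]

/-! ### Normal integral generators -/

/-- **`θ` generates an integral normal basis of `𝒪_E` over `𝒪_F`**: the conjugates `σθ` (`σ ∈ Aut_F(E)`) span `𝒪_E` as an `𝒪_F`-module
(equivalently `𝒪_E = 𝒪_F[Aut_F(E)]·θ`; for `E/F` Galois the conjugates are then a basis, `IsIntegralNormalGen.basis`).
[cite: SerreLocalFields1979, Ch. I §4 Prop. 10] -/
def IsIntegralNormalGen (θ : unitBall E) : Prop :=
  ⊤ ≤ Submodule.span 𝒪[F] (Set.range fun σ : E ≃ₐ[F] E => unitBallEquiv E σ θ)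

omit [FiniteDimensional F E] in
/-- Unfolding `IsIntegralNormalGen`. [cite: SerreLocalFields1979, Ch. I §4 Prop. 10] -/
theorem isIntegralNormalGen_iff [FiniteDimensional F E] (θ : unitBall E) :
    IsIntegralNormalGen E θ ↔ ⊤ ≤ Submodule.span 𝒪[F] (Set.range fun σ : E ≃ₐ[F] E => unitBallEquiv E σ θ) := Iff.rfl

include hπ in
/-- **Existence of normal integral generators for `E ⊆ F^{nr}` finite Galois** (the integral normal basis `(φ^iθ)_{i<[E:F]}` of
`LubinTateUnramifiedNormalBasis`, and `Gal(E/F) = ⟨φ⟩`). [cite: SerreLocalFields1979, Ch. I §4 Prop. 10] -/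
theorem exists_isIntegralNormalGen [IsGalois F E] (hE : E ≤ maxUnramified F) : ∃ θ : unitBall E, IsIntegralNormalGen E θ := by
  classical
  obtain ⟨σ₀, hσ₀⟩ := exists_isAbsArithFrob_holds F
  obtain ⟨φ, hφ⟩ : ∃ φ : unitBall E →+* unitBall E, φ = (frobUnitBall E σ₀ : unitBall E →+* unitBall E) := ⟨_, rfl⟩
  have hφa : ∀ t : 𝒪[F], φ (algebraMap 𝒪[F] (unitBall E) t) = algebraMap 𝒪[F] (unitBall E) t := fun t => by
    rw [hφ]; exact unitBallEquiv_algebraMap E _ t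
  have hφpow : ∀ c : unitBall E, φ c - c ^ residueFieldCard F ∈ Ideal.span {algebraMap 𝒪[F] (unitBall E) π} := fun c => by
    rw [hφ]; exact unitBallEquiv_sub_pow_mem hπ E hE hσ₀ _ (coe_restrictNormal_apply E σ₀) c
  obtain ⟨θ, b, hb⟩ := exists_basis_eq_pow_apply hπ E hE hφa hφpow
  refine ⟨θ, ?_⟩
  rw [isIntegralNormalGen_iff, ← b.span_eq]
  refine Submodule.span_mono ?_
  rintro _ ⟨i, rfl⟩
  refine ⟨((absoluteGaloisGroup.toAlgEquiv F σ₀).restrictNormal E) ^ (i : ℕ), ?_⟩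
  apply Subtype.ext
  rw [hb, hφ, coe_frobUnitBall_pow_apply, coe_unitBallEquiv]

variable {E}

/-- **For `E/F` Galois the conjugates of a normal integral generator are linearly independent** (`[E:F]` spanning vectors of a free
`𝒪_F`-module of rank `[E:F]`). [cite: SerreLocalFields1979, Ch. I §4 Prop. 10] -/
theorem IsIntegralNormalGen.linearIndependent [IsGalois F E] {θ : unitBall E} (hθ : IsIntegralNormalGen E θ) :
    LinearIndependent 𝒪[F] (fun σ : E ≃ₐ[F] E => unitBallEquiv E σ θ) := by
  classical
  haveI := module_free_unitBall E
  have hcard : Fintype.card (E ≃ₐ[F] E) = Module.finrank 𝒪[F] (unitBall E) := by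
    rw [← Nat.card_eq_fintype_card, IsGalois.card_aut_eq_finrank, finrank_integer_unitBall]
  exact linearIndependent_of_top_le_span_of_card_eq_finrank hθ hcard

/-- **The integral normal basis `(σθ)_{σ ∈ Gal(E/F)}` generated by `θ`.** [cite: SerreLocalFields1979, Ch. I §4 Prop. 10] -/
def IsIntegralNormalGen.basis [IsGalois F E] {θ : unitBall E} (hθ : IsIntegralNormalGen E θ) :
    Module.Basis (E ≃ₐ[F] E) 𝒪[F] (unitBall E) :=
  Module.Basis.mk hθ.linearIndependent hθ

/-- `hθ.basis σ = σθ`. [cite: SerreLocalFields1979, Ch. I §4 Prop. 10] -/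
theorem IsIntegralNormalGen.basis_apply [IsGalois F E] {θ : unitBall E} (hθ : IsIntegralNormalGen E θ) (σ : E ≃ₐ[F] E) :
    hθ.basis σ = unitBallEquiv E σ θ := by
  rw [IsIntegralNormalGen.basis, Module.Basis.mk_apply]

include hπ in
/-- ★ **Being a normal integral generator only depends on `θ mod π`** (`E ⊆ F^{nr}`, so `𝔪_E = π𝒪_E`): if `θ` is one and `‖θ′ − θ‖ < 1` then
`θ′` is one — the conjugates of `θ′` span `𝒪_E` modulo `𝔪_F𝒪_E`, hence span (Nakayama). [cite: SerreLocalFields1979, Ch. I §4 Prop. 10] -/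
theorem IsIntegralNormalGen.of_norm_sub_lt_one [Algebra.IsSeparable F E] (hE : E ≤ maxUnramified F) {θ θ' : unitBall E}
    (hθ : IsIntegralNormalGen E θ) (h : ‖((θ' - θ : unitBall E) : E)‖ < 1) : IsIntegralNormalGen E θ' := by
  obtain ⟨c, hc⟩ := exists_eq_algebraMap_mul_of_norm_lt_one hπ E hE h
  have hθeq : θ = θ' - algebraMap 𝒪[F] (unitBall E) π * c := by rw [← hc, sub_sub_cancel]
  have hπm : π ∈ 𝓂[F] := by
    rw [maximalIdeal_eq_span_singleton hπ]
    exact Ideal.mem_span_singleton_self π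
  have hNN : (⊤ : Submodule 𝒪[F] (unitBall E)) ≤
      Submodule.span 𝒪[F] (Set.range fun σ : E ≃ₐ[F] E => unitBallEquiv E σ θ') ⊔ 𝓂[F] • ⊤ := by
    refine hθ.trans (Submodule.span_le.mpr ?_)
    rintro _ ⟨σ, rfl⟩
    have e : unitBallEquiv E σ θ = unitBallEquiv E σ θ' - π • unitBallEquiv E σ c := by
      rw [hθeq, map_sub, map_mul, unitBallEquiv_algebraMap, Algebra.smul_def]
    change unitBallEquiv E σ θ ∈ _
    rw [e]
    exact Submodule.sub_mem _ (Submodule.mem_sup_left (Submodule.subset_span ⟨σ, rfl⟩))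
      (Submodule.mem_sup_right (Submodule.smul_mem_smul hπm Submodule.mem_top))
  haveI := module_finite_unitBall E
  exact Submodule.le_of_le_smul_of_le_jacobson_bot Module.Finite.fg_top (IsLocalRing.maximalIdeal_le_jacobson ⊥) hNN

include hπ in
/-- ★ **The set of normal integral generators is open** in `𝒪_E` (`E ⊆ F^{nr}`). [cite: SerreLocalFields1979, Ch. I §4 Prop. 10] -/
theorem isOpen_setOf_isIntegralNormalGen [Algebra.IsSeparable F E] (hE : E ≤ maxUnramified F) :
    IsOpen {θ : unitBall E | IsIntegralNormalGen E θ} := by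
  rw [Metric.isOpen_iff]
  intro θ hθ
  refine ⟨1, one_pos, fun θ' hθ' => IsIntegralNormalGen.of_norm_sub_lt_one hπ hE hθ ?_⟩
  rwa [Metric.mem_ball, Subtype.dist_eq, dist_eq_norm, ← AddSubgroupClass.coe_sub] at hθ'

include hπ in
/-- ★ **The set of normal integral generators is closed** in `𝒪_E` (`E ⊆ F^{nr}`; its complement is open for the same reason).
[cite: SerreLocalFields1979, Ch. I §4 Prop. 10] -/
theorem isClosed_setOf_isIntegralNormalGen [Algebra.IsSeparable F E] (hE : E ≤ maxUnramified F) :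
    IsClosed {θ : unitBall E | IsIntegralNormalGen E θ} := by
  rw [← isOpen_compl_iff, Metric.isOpen_iff]
  intro θ hθ
  refine ⟨1, one_pos, fun θ' hθ' hgen => hθ (IsIntegralNormalGen.of_norm_sub_lt_one hπ hE hgen ?_)⟩
  rw [Metric.mem_ball, Subtype.dist_eq, dist_comm, dist_eq_norm, ← AddSubgroupClass.coe_sub] at hθ'
  exact hθ'

/-! ### Traces of normal integral generators -/

variable {E₁ E₂ : IntermediateField F (AlgebraicClosure F)} [FiniteDimensional F E₁] [FiniteDimensional F E₂]

/-- ★★ **`Tr_{E₂/E₁}` maps normal integral generators to normal integral generators** (`E₁ ≤ E₂` finite Galois over `F`): for `y ∈ 𝒪_{E₁}` the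
coordinates of `ι y = Σ_σ a_σ σθ` are constant on the cosets of `Gal(E₂/E₁)` (they are unique and `ι y` is `Gal(E₂/E₁)`-fixed), so
`ι y = Σ_{σ̄} c_{σ̄} Σ_{σ|_{E₁} = σ̄} σθ = ι(Σ_{σ̄} c_{σ̄} σ̄ Tr θ)`. [cite: deShalit1987, Ch. III §1.3 (p. 90)] -/
theorem IsIntegralNormalGen.unitBallTrace [IsGalois F E₁] [IsGalois F E₂] (h : E₁ ≤ E₂) {θ : unitBall E₂} (hθ : IsIntegralNormalGen E₂ θ) :
    IsIntegralNormalGen E₁ (unitBallTrace h θ) := by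
  classical
  intro y _
  -- coordinates of `ι y`
  obtain ⟨a, ha⟩ : ∃ a : (E₂ ≃ₐ[F] E₂) → 𝒪[F], ∑ σ, a σ • unitBallEquiv E₂ σ θ = inclUnitBall (F := F) h y :=
    (Submodule.mem_span_range_iff_exists_fun 𝒪[F]).mp (hθ Submodule.mem_top)
  have hli := hθ.linearIndependent
  -- invariance of the coordinates under `Gal(E₂/E₁)`
  have hinv : ∀ τ : E₂ ≃ₐ[F] E₂, towerRestrict h τ = 1 → ∀ σ, a (τ * σ) = a σ := by
    intro τ hτ
    have hfix : unitBallEquiv E₂ τ⁻¹ (inclUnitBall (F := F) h y) = inclUnitBall (F := F) h y := by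
      apply Subtype.ext
      rw [coe_unitBallEquiv, coe_inclUnitBall]
      exact (towerRestrict_eq_one_iff h τ⁻¹).mp (by rw [map_inv, hτ, inv_one]) y
    have hsum' : ∑ σ, a (τ * σ) • unitBallEquiv E₂ σ θ = inclUnitBall (F := F) h y := by
      rw [← hfix, ← ha, map_sum]
      refine Fintype.sum_equiv (Equiv.mulLeft τ) _ _ fun σ => ?_
      rw [Equiv.coe_mulLeft, unitBallEquiv_smul, ← unitBallEquiv_mul_apply, inv_mul_cancel_left]
    have hzero : ∑ σ, (a (τ * σ) - a σ) • unitBallEquiv E₂ σ θ = 0 := by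
      simp only [sub_smul, Finset.sum_sub_distrib, hsum', ha, sub_self]
    intro σ
    exact sub_eq_zero.mp (Fintype.linearIndependent_iff.mp hli (fun σ => a (τ * σ) - a σ) hzero σ)
  -- the coordinates as a function on `Gal(E₁/F)`
  obtain ⟨s, hs⟩ : ∃ s : (E₁ ≃ₐ[F] E₁) → (E₂ ≃ₐ[F] E₂), ∀ ρ, towerRestrict h (s ρ) = ρ :=
    ⟨Function.surjInv (towerRestrict_surjective h), Function.surjInv_eq (towerRestrict_surjective h)⟩
  have hac : ∀ σ, a σ = a (s (towerRestrict h σ)) := by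
    intro σ
    have h1 : towerRestrict h (σ * (s (towerRestrict h σ))⁻¹) = 1 := by rw [map_mul, map_inv, hs, mul_inv_cancel]
    have h2 := hinv _ h1 (s (towerRestrict h σ))
    rwa [inv_mul_cancel_right] at h2
  -- regroup the sum along the fibres of the restriction
  have key : inclUnitBall (F := F) h y =
      inclUnitBall (F := F) h (∑ ρ : E₁ ≃ₐ[F] E₁, a (s ρ) •
        unitBallEquiv E₁ ρ (_root_.Literature.NumberTheory.GaloisRepresentations.unitBallTrace h θ)) := by
    rw [map_sum, ← ha, ← Finset.sum_fiberwise Finset.univ (towerRestrict h) (fun σ => a σ • unitBallEquiv E₂ σ θ)]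
    refine Finset.sum_congr rfl fun ρ _ => ?_
    rw [inclUnitBall_smul, inclUnitBall_unitBallEquiv_unitBallTrace, Finset.smul_sum]
    refine Finset.sum_congr rfl fun σ hσ => ?_
    rw [Finset.mem_filter] at hσ
    rw [hac σ, hσ.2]
  rw [(inclUnitBall_injective h key : y = _)]
  exact Submodule.sum_mem _ fun ρ _ => Submodule.smul_mem _ _ (Submodule.subset_span ⟨ρ, rfl⟩)

/-- **`Tr_{E₂/E₁}(𝒪_{E₂}) = 𝒪_{E₁}`** for `E₁ ≤ E₂ ⊆ F^{nr}` finite Galois (`𝒪_{E₁}` is spanned by the conjugates of `Tr θ`, and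
`σ̄ Tr θ = Tr(σθ)` for a lift `σ`). [cite: SerreLocalFields1979, Ch. V §2] -/
theorem unitBallTrace_surjective [IsGalois F E₁] [IsGalois F E₂] (h : E₁ ≤ E₂) (hE₂ : E₂ ≤ maxUnramified F)
    (hπ : (valuation F).IsUniformizer (π : F)) : Function.Surjective (unitBallTrace h) := by
  classical
  obtain ⟨θ, hθ⟩ := exists_isIntegralNormalGen hπ E₂ hE₂
  have hTr := hθ.unitBallTrace h
  intro y
  obtain ⟨c, hc⟩ : ∃ c : (E₁ ≃ₐ[F] E₁) → 𝒪[F], ∑ ρ, c ρ • unitBallEquiv E₁ ρ (unitBallTrace h θ) = y :=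
    (Submodule.mem_span_range_iff_exists_fun 𝒪[F]).mp (hTr Submodule.mem_top)
  obtain ⟨s, hs⟩ : ∃ s : (E₁ ≃ₐ[F] E₁) → (E₂ ≃ₐ[F] E₂), ∀ ρ, towerRestrict h (s ρ) = ρ :=
    ⟨Function.surjInv (towerRestrict_surjective h), Function.surjInv_eq (towerRestrict_surjective h)⟩
  refine ⟨∑ ρ, c ρ • unitBallEquiv E₂ (s ρ) θ, ?_⟩
  rw [map_sum, ← hc]
  refine Finset.sum_congr rfl fun ρ _ => ?_
  rw [map_smul, unitBallTrace_unitBallEquiv, hs]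

/-! ### Trace-coherent normal integral generators along a tower -/

/-- ★★★ **Trace-coherent integral normal bases along an unramified tower**: for finite Galois subextensions `E₀ ≤ E₁ ≤ ⋯` of `F^{nr}`
there are normal integral generators `θ_m ∈ 𝒪_{E_m}` with `Tr_{E_{m+1}/E_m} θ_{m+1} = θ_m` for every `m`.  Proof: in the compact space
`∏_m 𝒪_{E_m}` the sets `T_M` of families that are generators up to level `M` and trace-coherent below level `M` are closed
(`isClosed_setOf_isIntegralNormalGen`, continuity of the traces), decreasing, and non-empty (push a generator of level `M` down by the
traces, `IsIntegralNormalGen.unitBallTrace`, transitivity); Cantor's intersection theorem gives a point of `⋂_M T_M`.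
[cite: deShalit1987, Ch. I §3.8 (16)–(17); Ch. III §1.3 (p. 90)] -/
theorem exists_traceCoherent_isIntegralNormalGen (hπ : (valuation F).IsUniformizer (π : F))
    (E : ℕ → IntermediateField F (AlgebraicClosure F)) [∀ m, FiniteDimensional F (E m)] [∀ m, IsGalois F (E m)]
    (hmono : Monotone E) (hE : ∀ m, E m ≤ maxUnramified F) :
    ∃ θ : ∀ m, unitBall (E m), (∀ m, IsIntegralNormalGen (E m) (θ m)) ∧
      ∀ m, unitBallTrace (hmono (Nat.le_succ m)) (θ (m + 1)) = θ m := by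
  classical
  haveI : ∀ m, CompactSpace (unitBall (E m)) := fun m => compactSpace_unitBall (E m)
  obtain ⟨T, hT⟩ : ∃ T : ℕ → Set (∀ m, unitBall (E m)), T = fun M =>
      {x | ∀ m ≤ M, IsIntegralNormalGen (E m) (x m)} ∩
        {x | ∀ m < M, unitBallTrace (hmono (Nat.le_succ m)) (x (m + 1)) = x m} := ⟨_, rfl⟩
  have hclosed : ∀ M, IsClosed (T M) := by
    intro M
    rw [hT]
    refine IsClosed.inter ?_ ?_
    · have e : {x : ∀ m, unitBall (E m) | ∀ m ≤ M, IsIntegralNormalGen (E m) (x m)} =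
          ⋂ m, ⋂ (_ : m ≤ M), (fun x : ∀ m, unitBall (E m) => x m) ⁻¹' {θ | IsIntegralNormalGen (E m) θ} := by
        ext x; simp only [Set.mem_setOf_eq, Set.mem_iInter, Set.mem_preimage]
      rw [e]
      exact isClosed_iInter fun m => isClosed_iInter fun _ =>
        (isClosed_setOf_isIntegralNormalGen hπ (hE m)).preimage (continuous_apply m)
    · have e : {x : ∀ m, unitBall (E m) | ∀ m < M, unitBallTrace (hmono (Nat.le_succ m)) (x (m + 1)) = x m} =
          ⋂ m, ⋂ (_ : m < M), {x | unitBallTrace (hmono (Nat.le_succ m)) (x (m + 1)) = x m} := by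
        ext x; simp only [Set.mem_setOf_eq, Set.mem_iInter]
      rw [e]
      exact isClosed_iInter fun m => isClosed_iInter fun _ =>
        isClosed_eq ((continuous_unitBallTrace (hmono (Nat.le_succ m))).comp (continuous_apply (m + 1))) (continuous_apply m)
  have hne : ∀ M, (T M).Nonempty := by
    intro M
    obtain ⟨θM, hθM⟩ := exists_isIntegralNormalGen hπ (E M) (hE M)
    refine ⟨fun m => if hm : m ≤ M then unitBallTrace (hmono hm) θM else 0, ?_⟩
    rw [hT]
    refine ⟨fun m hm => ?_, fun m hm => ?_⟩
    · simp only [dif_pos hm]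
      exact hθM.unitBallTrace (hmono hm)
    · have hm1 : m + 1 ≤ M := hm
      have hm0 : m ≤ M := le_of_lt hm
      simp only [dif_pos hm1, dif_pos hm0]
      exact unitBallTrace_unitBallTrace _ _ θM
  have hanti : ∀ M, T (M + 1) ⊆ T M := by
    intro M x hx
    rw [hT] at hx ⊢
    exact ⟨fun m hm => hx.1 m (Nat.le_succ_of_le hm), fun m hm => hx.2 m (Nat.lt_succ_of_lt hm)⟩
  obtain ⟨x, hx⟩ := IsCompact.nonempty_iInter_of_sequence_nonempty_isCompact_isClosed T hanti hne (hclosed 0).isCompact hclosed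
  rw [Set.mem_iInter] at hx
  refine ⟨x, fun m => ?_, fun m => ?_⟩
  · have h1 := hx m
    rw [hT] at h1
    exact h1.1 m le_rfl
  · have h1 := hx (m + 1)
    rw [hT] at h1
    exact h1.2 m (Nat.lt_succ_self m)

end UnramifiedNormalGen

end Literature.NumberTheory.GaloisRepresentations
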